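import Mathlib
import Summits.AnomalousDissipation.AnomalousDissipation.Theorems.SoloBlindVarahBound

/-!
# SoloBlindWeightedVarah — Varah's `ℓ∞` bound in a weighted norm, and the reflection-row weight `w₀ = 1/√2`

Kernel #268 (`VarahBound`) gives `‖y‖_∞ ≤ ‖A y‖_∞ / δ` for rows dominant with margin `δ`.  Applied to the
streak chain verbatim it needs `δ = √2 g² t − (√2 − 1)` because the second row `√2 s₀ − β₁ s₁ + s₂` has
off-diagonal sum `1 + √2 > 2`; that margin is NEGATIVE for `√2 g² t < √2 − 1`, i.e. on `t ∈ [10.4, (√2−1)/(√2 g²)]`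
for the small-`g` pieces — a gap in the outer lemma (o) as recorded (gen104 finding).  The repair is a diagonal
similarity: in the weighted sup-norm `max_i ‖y i‖ / w i` with `w₀ = 1/√2`, `w_m = 1 (m ≥ 1)` the weighted
off-diagonal sums of ALL streak rows equal `2`, so the margin is the full `δ = √2 g² t > 0` for every `t > 0`.
This file proves the weighted Varah bound (by rescaling `A ↦ W⁻¹ A W` and invoking #268), invertibility, the
unweighted corollary with the condition factor `w_max / w_min` (`= √2` here), and the two row identities.
-/

namespace Summit.AnomalousDissipation.SoloBlind.WeightedVarah

open Matrix Finset

variable {n : ℕ}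

/-- The diagonally rescaled matrix `(W⁻¹ A W) i j = A i j · (w j / w i)`. -/
noncomputable def rescale (A : Matrix (Fin n) (Fin n) ℂ) (w : Fin n → ℝ) : Matrix (Fin n) (Fin n) ℂ :=
  fun i j => A i j * ((w j / w i : ℝ) : ℂ)

/-- Rescaling keeps the diagonal norms. -/
theorem rescale_diag_norm (A : Matrix (Fin n) (Fin n) ℂ) (w : Fin n → ℝ) (hw : ∀ i, 0 < w i) (i : Fin n) :
    ‖rescale A w i i‖ = ‖A i i‖ := by
  simp [rescale, div_self (hw i).ne']

/-- Rescaling multiplies the off-diagonal norms by `w j / w i`. -/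
theorem rescale_norm (A : Matrix (Fin n) (Fin n) ℂ) (w : Fin n → ℝ) (hw : ∀ i, 0 < w i) (i j : Fin n) :
    ‖rescale A w i j‖ = ‖A i j‖ * (w j / w i) := by
  rw [rescale, norm_mul, Complex.norm_real, Real.norm_of_nonneg (div_nonneg (hw j).le (hw i).le)]

/-- `W⁻¹ A W` applied to `W⁻¹ y` is `W⁻¹ (A y)`. -/
theorem rescale_mulVec (A : Matrix (Fin n) (Fin n) ℂ) (w : Fin n → ℝ) (hw : ∀ i, 0 < w i)
    (y : Fin n → ℂ) (i : Fin n) :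
    (rescale A w *ᵥ fun j => y j / (w j : ℂ)) i = (A *ᵥ y) i / (w i : ℂ) := by
  simp only [mulVec, dotProduct, rescale]
  rw [Finset.sum_div]
  refine Finset.sum_congr rfl fun j _ => ?_
  have hwj : (w j : ℂ) ≠ 0 := by exact_mod_cast (hw j).ne'
  have hwi : (w i : ℂ) ≠ 0 := by exact_mod_cast (hw i).ne'
  push_cast
  field_simp

/-- **Weighted Varah bound.**  If every row is dominant with margin `δ > 0` in the weighted sense
`δ + ∑_{j ≠ i} ‖A i j‖ (w j / w i) ≤ ‖A i i‖` (weights `w > 0`), then a solution of `A y = x` with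
`‖x i‖ ≤ X · w i` satisfies `‖y i‖ ≤ (X/δ) · w i`. -/
theorem sup_le_of_eq_weighted (A : Matrix (Fin n) (Fin n) ℂ) (w : Fin n → ℝ) (hw : ∀ i, 0 < w i)
    {δ X : ℝ} (hδ : 0 < δ)
    (hA : ∀ i, δ + ∑ j ∈ univ.erase i, ‖A i j‖ * (w j / w i) ≤ ‖A i i‖)
    {x y : Fin n → ℂ} (hxy : A *ᵥ y = x) (hX : ∀ i, ‖x i‖ ≤ X * w i) :
    ∀ i, ‖y i‖ ≤ X / δ * w i := by
  have hA' : ∀ i, δ + ∑ j ∈ univ.erase i, ‖rescale A w i j‖ ≤ ‖rescale A w i i‖ := by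
    intro i; rw [rescale_diag_norm A w hw]; simpa [rescale_norm A w hw] using hA i
  have hxy' : (rescale A w *ᵥ fun j => y j / (w j : ℂ)) = fun i => x i / (w i : ℂ) := by
    funext i; rw [rescale_mulVec A w hw, hxy]
  have hX' : ∀ i, ‖x i / (w i : ℂ)‖ ≤ X := by
    intro i
    rw [norm_div, Complex.norm_real, Real.norm_of_nonneg (hw i).le, div_le_iff₀ (hw i)]
    exact hX i
  intro i
  have h := VarahBound.sup_le_of_eq (rescale A w) hδ hA' hxy' hX' i
  rw [norm_div, Complex.norm_real, Real.norm_of_nonneg (hw i).le, div_le_iff₀ (hw i)] at h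
  exact h

/-- **Unweighted corollary with the condition factor**: if `‖x i‖ ≤ X` for all `i` and `wmin ≤ w i ≤ wmax`
(`0 < wmin`), then `‖y i‖ ≤ X · wmax / (wmin · δ)` — for the reflection weight this is the factor `√2`. -/
theorem sup_le_of_eq_cond (A : Matrix (Fin n) (Fin n) ℂ) (w : Fin n → ℝ) {wmin wmax : ℝ} (hmin : 0 < wmin)
    (hlo : ∀ i, wmin ≤ w i) (hhi : ∀ i, w i ≤ wmax) {δ X : ℝ} (hδ : 0 < δ) (hX0 : 0 ≤ X)
    (hA : ∀ i, δ + ∑ j ∈ univ.erase i, ‖A i j‖ * (w j / w i) ≤ ‖A i i‖)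
    {x y : Fin n → ℂ} (hxy : A *ᵥ y = x) (hX : ∀ i, ‖x i‖ ≤ X) :
    ∀ i, ‖y i‖ ≤ X * wmax / (wmin * δ) := by
  have hw : ∀ i, 0 < w i := fun i => lt_of_lt_of_le hmin (hlo i)
  have hX' : ∀ i, ‖x i‖ ≤ X / wmin * w i := by
    intro i
    calc ‖x i‖ ≤ X := hX i
      _ = X / wmin * wmin := by field_simp
      _ ≤ X / wmin * w i := mul_le_mul_of_nonneg_left (hlo i) (div_nonneg hX0 hmin.le)
  intro i
  have h := sup_le_of_eq_weighted A w hw hδ hA hxy hX' i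
  calc ‖y i‖ ≤ X / wmin / δ * w i := h
    _ ≤ X / wmin / δ * wmax := mul_le_mul_of_nonneg_left (hhi i) (div_nonneg (div_nonneg hX0 hmin.le) hδ.le)
    _ = X * wmax / (wmin * δ) := by field_simp

/-- **Invertibility** under weighted dominance. -/
theorem isUnit_of_weighted (A : Matrix (Fin n) (Fin n) ℂ) (w : Fin n → ℝ) (hw : ∀ i, 0 < w i)
    {δ : ℝ} (hδ : 0 < δ) (hA : ∀ i, δ + ∑ j ∈ univ.erase i, ‖A i j‖ * (w j / w i) ≤ ‖A i i‖) :
    IsUnit A := by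
  rw [← Matrix.mulVec_injective_iff_isUnit]
  intro y₁ y₂ h
  have h0 : A *ᵥ (y₁ - y₂) = 0 := by rw [Matrix.mulVec_sub]; exact sub_eq_zero.mpr h
  have hb := sup_le_of_eq_weighted A w hw hδ (X := 0) hA h0 (fun i => by simp)
  funext i
  have : ‖(y₁ - y₂) i‖ ≤ 0 := by simpa using hb i
  exact sub_eq_zero.mp (norm_le_zero_iff.mp this)

/-- Weighted margin from a diagonal lower bound `D` and a weighted off-diagonal bound `S < D`. -/
theorem margin_of_weighted_bounds (A : Matrix (Fin n) (Fin n) ℂ) (w : Fin n → ℝ) {D S : ℝ}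
    (hD : ∀ i, D ≤ ‖A i i‖) (hS : ∀ i, ∑ j ∈ univ.erase i, ‖A i j‖ * (w j / w i) ≤ S) :
    ∀ i, (D - S) + ∑ j ∈ univ.erase i, ‖A i j‖ * (w j / w i) ≤ ‖A i i‖ :=
  fun i => by linarith [hD i, hS i]

/-- REFLECTION WEIGHT, row 0 of the streak chain `-β₀ s₀ + √2 s₁`: weighted off-diagonal sum
`√2 · (w₁ / w₀) = √2 · (1 / (1/√2)) = 2`. -/
theorem reflection_row0 : Real.sqrt 2 * (1 / (1 / Real.sqrt 2)) = 2 := by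
  rw [one_div_one_div]; exact Real.mul_self_sqrt (by norm_num)

/-- REFLECTION WEIGHT, row 1 `√2 s₀ − β₁ s₁ + s₂`: weighted off-diagonal sum `√2 · (w₀ / w₁) + 1 · (w₂ / w₁) = 1 + 1 = 2`
(the unweighted sum is `1 + √2`). Rows `m ≥ 2` keep the sum `2`; roll rows `(m−2)/(m−1) + (m+2)/(m+1) < 2`. -/
theorem reflection_row1 : Real.sqrt 2 * ((1 / Real.sqrt 2) / 1) + 1 * (1 / 1) = 2 := by
  have h : Real.sqrt 2 ≠ 0 := by positivity
  field_simp
  ring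

/-- Roll rows: `(m−2)/(m−1) + (m+2)/(m+1) ≤ 2` for `m ≥ 2` (so the weight `1` suffices there). -/
theorem roll_row_sum_le (m : ℝ) (hm : 2 ≤ m) : (m - 2) / (m - 1) + (m + 2) / (m + 1) ≤ 2 := by
  have h1 : 0 < m - 1 := by linarith
  have h2 : 0 < m + 1 := by linarith
  rw [div_add_div _ _ h1.ne' h2.ne', div_le_iff₀ (mul_pos h1 h2)]
  nlinarith

end Summit.AnomalousDissipation.SoloBlind.WeightedVarah
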